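import Mathlib
import Summits.RiemannHypothesis.RiemannHypothesis.Theorems.HandoffDecomposition
import HarnessLib

/-!
# HANDOFF — THE FLAT-EDGE LAW: to first order in the layer width the new prime's atom is RANK ONE — minus/plus `w_q δ` times the squared
# EDGE VALUE at the entrance point `(log q)/2` (cell rh-explicit, TRACK «HANDOFF», seat theory-2 gen12; FILE XII-ε; RH-free, elementary)

HONEST FRAMING. Nothing in this file bears on the truth of RH; every statement is RH-free real analysis on one test function. The cell's
whole «rank-one pencil» picture of the handoff wall (XII-l `HandoffRankOnePencil`, XII-h `HandoffCapacity`, XII-x `HandoffSecularPencil`,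
the LADDER note §3: `gain_k = flat_k·c_δ·η_k²`, `c_δ = w_q·δ`, `w_q = 4 log q/√q`; kappa.py's docstring «for ODD g nearly constant (= η) on
the layer, gᵀ(G_S − G_F)g ≈ −4Λ(q)q^{−1/2} δ η² (rank one, e = evaluation at b⁻)») rests on ONE approximation: on the thin layer
`[log q − b, b]` (width `2δ`, `δ = b − (log q)/2`) through which the new prime acts, a smooth test function is nearly constant, so the atom's
bilinear form collapses to (edge value)². This file makes that an INEQUALITY with an explicit `O(δ²)` remainder:
§1 (`contribution_eq_neg_mul_re_layerIntegral`) prove-2's `contribution q g = −(2 log q/√q)·Re (g ⋆ g̃)(log q)` unfolded and restricted to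
   where it lives: `contribution_q(g) = −(2 log q/√q)·Re ∫_{[log q − b, b]} g(u)·conj g(u − log q) du` for `tsupport g ⊆ [−b, b]` (the cross
   integrand vanishes off the layer, `mul_conj_shift_eq_zero_of_not_mem_layer`);
§2 (`norm_layerIntegral_sub_flat_le`) THE FLAT-EDGE ESTIMATE: with `m = (log q)/2` and `g` `M`-Lipschitz about `m` on the layer and about
   `−m` on the mirror layer, `‖∫_{layer} g(u)·conj g(u − log q) du − 2δ·g(m)·conj g(−m)‖ ≤ 2δ·Mδ·(‖g(m)‖ + ‖g(−m)‖ + Mδ)`;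
§3 (`abs_contribution_add_flat_le`) hence `|contribution_q(g) + w_q δ·Re(g(m)·conj g(−m))| ≤ w_q δ·Mδ·(‖g(m)‖ + ‖g(−m)‖ + Mδ)` — to first
   order in `δ` the atom is the RANK-ONE form `−w_q δ·Re(g(m)·conj g(−m))` in the two edge values; its PARITY FACES: EVEN `g` is CHARGED
   `w_q δ·‖g(m)‖²` (`abs_contribution_add_flat_le_of_even`), ODD `g` is REWARDED `w_q δ·‖g(m)‖²` (`abs_contribution_sub_flat_le_of_odd`) —
   «odd carries the wall, even pays» at first order, RH-free;
§4 the Lipschitz modulus from a derivative bound `‖g′‖ ≤ M` on the layer (mean value inequality), and the two faces in that form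
   (`…_of_deriv_le`).
What is NOT here (DATA/MODEL): that the near-null LADDER modes of the full form's section are flat on the layer (their `flat_k`, the
correction factors 14.5 → 5.4 the cell measures, are exactly `1 +` this file's remainder/main ratio, mode by mode — DATA); anything
about eigenvalues, walls or ζ. Exact companions: XII-p `HandoffEntranceSignLayer` (sign), XII-q `HandoffMirrorPolarization` (the exact
± mirror decomposition of the same layer integral), XII-c `HandoffEdgeLayer` / `HandoffCapSharp` (`|contribution| ≤ cap‖g‖²`, sharp).
References: A. Connes, C. Consani, Enseign. Math. 69 (2023) §2.2–§2.3 [`ConnesConsani2023`]; E. Bombieri, Rend. Mat. Acc. Lincei (9) 11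
(2000) §2 [`Bombieri2000Weil`] (the convolution face); the estimate is this track's bookkeeping [folklore].
-/

set_option linter.dupNamespace false  -- the mandated namespace repeats `RiemannHypothesis`

noncomputable section

open Set Complex MeasureTheory Literature.NumberTheory.LFunctions
open Summit.RiemannHypothesis.RiemannHypothesis.Theorems.Handoff (contribution)
open Summit.RiemannHypothesis.RiemannHypothesis.Theorems.HandoffDecomposition (contribution_eq_two_mul)
open scoped ComplexConjugate

namespace Summit.RiemannHypothesis.RiemannHypothesis.Theorems.HandoffFlatEdge

variable {g : ℝ → ℂ} {b : ℝ}

/-! ## §1 The atom's cross term lives on the layer `[log q − b, b]` -/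

/-- Off the layer `[L − b, b]` the cross integrand `g(u)·conj g(u − L)` of a test function supported in `[−b, b]` vanishes. [folklore] -/
theorem mul_conj_shift_eq_zero_of_not_mem_layer (hsupp : tsupport g ⊆ Icc (-b) b) {L u : ℝ} (hu : u ∉ Icc (L - b) b) :
    g u * conj (g (u - L)) = 0 := by
  by_contra h
  have h1 : g u ≠ 0 := fun h0 ↦ h (by rw [h0, zero_mul])
  have h2 : g (u - L) ≠ 0 := fun h0 ↦ h (by rw [h0, map_zero, mul_zero])
  have hu1 := hsupp (subset_tsupport g (Function.mem_support.mpr h1))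
  have hu2 := hsupp (subset_tsupport g (Function.mem_support.mpr h2))
  exact hu ⟨by linarith [hu2.1], hu1.2⟩

/-- **The contribution of `q` as a LAYER integral**: `contribution_q(g) = −(2 log q/√q)·Re ∫_{[log q − b, b]} g(u)·conj g(u − log q) du`
for `tsupport g ⊆ [−b, b]` (prove-2's `contribution_eq_two_mul` with the convolution unfolded and restricted to where it lives).
[folklore; Bombieri2000Weil §2 for the convolution] -/
theorem contribution_eq_neg_mul_re_layerIntegral (hsupp : tsupport g ⊆ Icc (-b) b) (q : ℕ) :
    contribution q g = -(2 * Real.log q / Real.sqrt q *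
      (∫ u in Icc (Real.log q - b) b, g u * conj (g (u - Real.log q))).re) := by
  rw [contribution_eq_two_mul, weilConv_apply]
  have e : (fun u ↦ g u * weilReflect g (Real.log q - u)) = fun u ↦ g u * conj (g (u - Real.log q)) := by
    funext u
    simp [weilReflect, neg_sub]
  rw [e, ← setIntegral_eq_integral_of_forall_compl_eq_zero (s := Icc (Real.log q - b) b)
    (fun u hu ↦ mul_conj_shift_eq_zero_of_not_mem_layer hsupp hu)]

/-! ## §2 The flat-edge estimate: the layer integral is `2δ·g(m)·conj g(−m)` up to `O(δ²)` -/

/-- **THE FLAT-EDGE ESTIMATE.** Let `L = log q`, `m = L/2` (the entrance point), `δ = b − m ≥ 0` (so the layer is `[m − δ, m + δ]`, width `2δ`),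
and let `g` be `M`-Lipschitz about `m` on the layer and about `−m` on the mirror layer `[−m − δ, −m + δ]`. Then
`‖∫_{layer} g(u)·conj g(u − L) du − 2δ·g(m)·conj g(−m)‖ ≤ 2δ · Mδ·(‖g(m)‖ + ‖g(−m)‖ + Mδ)`: to first order in the width the cross term
is the product of the two EDGE VALUES — a rank-one bilinear form (evaluation at `±m`). (Mean-value bookkeeping; no parity, no smoothness
beyond the Lipschitz moduli.) [folklore] -/
theorem norm_layerIntegral_sub_flat_le (hg : IsWeilTest g) {q : ℕ} {M : ℝ} (hM0 : 0 ≤ M) (hb : Real.log q / 2 ≤ b)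
    (hM : ∀ u ∈ Icc (Real.log q - b) b, ‖g u - g (Real.log q / 2)‖ ≤ M * |u - Real.log q / 2|)
    (hM' : ∀ v ∈ Icc (-b) (b - Real.log q), ‖g v - g (-(Real.log q / 2))‖ ≤ M * |v + Real.log q / 2|) :
    ‖(∫ u in Icc (Real.log q - b) b, g u * conj (g (u - Real.log q)))
        - (2 * (b - Real.log q / 2) : ℝ) • (g (Real.log q / 2) * conj (g (-(Real.log q / 2))))‖
      ≤ 2 * (b - Real.log q / 2) * (M * (b - Real.log q / 2) *
          (‖g (Real.log q / 2)‖ + ‖g (-(Real.log q / 2))‖ + M * (b - Real.log q / 2))) := by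
  set L := Real.log q with hL
  set m := Real.log q / 2 with hm
  set δ := b - m with hδ
  set S : Set ℝ := Icc (L - b) b with hS
  set c : ℂ := g m * conj (g (-m)) with hc
  have hδ0 : 0 ≤ δ := by rw [hδ]; linarith
  have hLb : L - b ≤ b := by rw [hL]; linarith
  have hvol : volume.real S = 2 * δ := by
    rw [hS, Real.volume_real_Icc_of_le hLb, hδ, hm]; ring
  have hSfin : volume S < ⊤ := by rw [hS]; exact measure_Icc_lt_top
  -- integrability of the cross term on the layer (continuous integrand, compact set)
  have hcont : Continuous fun u ↦ g u * conj (g (u - L)) :=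
    hg.1.continuous.mul (Complex.continuous_conj.comp (hg.1.continuous.comp (continuous_id.sub continuous_const)))
  have hint : IntegrableOn (fun u ↦ g u * conj (g (u - L))) S volume :=
    hcont.continuousOn.integrableOn_compact isCompact_Icc
  -- rewrite the flat term as the integral of a constant over the layer
  have hconst : (2 * δ : ℝ) • c = ∫ u in S, c := by
    rw [setIntegral_const, hvol, Complex.real_smul]
  rw [hconst, ← integral_sub hint (by rw [hS]; exact integrableOn_const (by simp))]
  -- pointwise bound on the layer
  have hpt : ∀ u ∈ S, ‖g u * conj (g (u - L)) - c‖ ≤ M * δ * (‖g m‖ + ‖g (-m)‖ + M * δ) := by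
    intro u hu
    have hu' : |u - m| ≤ δ := by
      rw [abs_le]; rw [hS, mem_Icc] at hu; constructor <;> [linarith [hu.1]; linarith [hu.2]]
    have hv : u - L ∈ Icc (-b) (b - L) := by rw [hS, mem_Icc] at hu; exact ⟨by linarith [hu.1], by linarith [hu.2]⟩
    have hv' : |u - L + m| ≤ δ := by
      have : u - L + m = u - m := by rw [hm, hL]; ring
      rw [this]; exact hu'
    have h1 : ‖g u - g m‖ ≤ M * δ := (hM u hu).trans (mul_le_mul_of_nonneg_left hu' hM0)
    have h2 : ‖g (u - L) - g (-m)‖ ≤ M * δ := by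
      have h := hM' (u - L) hv
      rw [show u - L + Real.log q / 2 = u - L + m from by rw [hm]] at h
      exact h.trans (mul_le_mul_of_nonneg_left hv' hM0)
    have h3 : ‖g (u - L)‖ ≤ ‖g (-m)‖ + M * δ := by
      calc ‖g (u - L)‖ = ‖g (-m) + (g (u - L) - g (-m))‖ := by ring_nf
        _ ≤ ‖g (-m)‖ + ‖g (u - L) - g (-m)‖ := norm_add_le _ _
        _ ≤ ‖g (-m)‖ + M * δ := by linarith [h2]
    have hsplit : g u * conj (g (u - L)) - c = (g u - g m) * conj (g (u - L)) + g m * (conj (g (u - L)) - conj (g (-m))) := by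
      rw [hc]; ring
    rw [hsplit]
    calc ‖(g u - g m) * conj (g (u - L)) + g m * (conj (g (u - L)) - conj (g (-m)))‖
        ≤ ‖(g u - g m) * conj (g (u - L))‖ + ‖g m * (conj (g (u - L)) - conj (g (-m)))‖ := norm_add_le _ _
      _ = ‖g u - g m‖ * ‖g (u - L)‖ + ‖g m‖ * ‖g (u - L) - g (-m)‖ := by
          rw [norm_mul, norm_mul, Complex.norm_conj, ← map_sub, Complex.norm_conj]
      _ ≤ M * δ * (‖g (-m)‖ + M * δ) + ‖g m‖ * (M * δ) := by
          gcongr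
      _ = M * δ * (‖g m‖ + ‖g (-m)‖ + M * δ) := by ring
  have hmain := norm_setIntegral_le_of_norm_le_const hSfin hpt
  rw [hvol] at hmain
  calc ‖∫ u in S, g u * conj (g (u - L)) - c‖ ≤ M * δ * (‖g m‖ + ‖g (-m)‖ + M * δ) * (2 * δ) := hmain
    _ = 2 * δ * (M * δ * (‖g m‖ + ‖g (-m)‖ + M * δ)) := by ring

/-! ## §3 The flat-edge law for the contribution, and its two parity faces -/

/-- **THE FLAT-EDGE LAW (parity-free).** With `L = log q`, `m = L/2`, `δ = b − m ≥ 0` and `g` supported in `[−b, b]`, `M`-Lipschitz about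
`m` on the layer and about `−m` on the mirror layer:
`|contribution_q(g) + (2 log q/√q)·2δ·Re(g(m)·conj g(−m))| ≤ (2 log q/√q)·2δ·Mδ·(‖g(m)‖ + ‖g(−m)‖ + Mδ)` —
the atom of `q` is, to first order in the layer width `2δ`, the rank-one form `−w_q δ·Re(g(m)·conj g(−m))` (`w_q = 4 log q/√q`) in the
two EDGE VALUES, with an `O(δ²)` remainder controlled by the slope of `g` on the layers. This is the «flat-edge» approximation behind the
cell's rank-one pencil / secular pictures (XII-l, XII-x; kappa.py's `c(δ) = w_q·δ`), as an inequality. [folklore] -/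
theorem abs_contribution_add_flat_le (hg : IsWeilTest g) (hsupp : tsupport g ⊆ Icc (-b) b) {q : ℕ} {M : ℝ} (hM0 : 0 ≤ M)
    (hb : Real.log q / 2 ≤ b) (hM : ∀ u ∈ Icc (Real.log q - b) b, ‖g u - g (Real.log q / 2)‖ ≤ M * |u - Real.log q / 2|)
    (hM' : ∀ v ∈ Icc (-b) (b - Real.log q), ‖g v - g (-(Real.log q / 2))‖ ≤ M * |v + Real.log q / 2|) :
    |contribution q g + 2 * Real.log q / Real.sqrt q * (2 * (b - Real.log q / 2)) *
        (g (Real.log q / 2) * conj (g (-(Real.log q / 2)))).re|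
      ≤ 2 * Real.log q / Real.sqrt q * (2 * (b - Real.log q / 2) * (M * (b - Real.log q / 2) *
          (‖g (Real.log q / 2)‖ + ‖g (-(Real.log q / 2))‖ + M * (b - Real.log q / 2)))) := by
  have hcq : 0 ≤ 2 * Real.log q / Real.sqrt q :=
    div_nonneg (mul_nonneg zero_le_two (Real.log_natCast_nonneg q)) (Real.sqrt_nonneg _)
  rw [contribution_eq_neg_mul_re_layerIntegral hsupp q]
  set cq := 2 * Real.log q / Real.sqrt q with hcq_def
  set I := ∫ u in Icc (Real.log q - b) b, g u * conj (g (u - Real.log q)) with hI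
  set c : ℂ := (2 * (b - Real.log q / 2) : ℝ) • (g (Real.log q / 2) * conj (g (-(Real.log q / 2)))) with hc
  have hre : |I.re - c.re| ≤ ‖I - c‖ := by
    rw [← Complex.sub_re]
    exact Complex.abs_re_le_norm _
  have hflat := norm_layerIntegral_sub_flat_le hg hM0 hb hM hM'
  have hcre : c.re = 2 * (b - Real.log q / 2) * (g (Real.log q / 2) * conj (g (-(Real.log q / 2)))).re := by
    rw [hc, Complex.real_smul, Complex.re_ofReal_mul]
  have e : -(cq * I.re) + cq * (2 * (b - Real.log q / 2)) * (g (Real.log q / 2) * conj (g (-(Real.log q / 2)))).re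
      = -(cq * (I.re - c.re)) := by
    rw [hcre]; ring
  rw [e, abs_neg, abs_mul, abs_of_nonneg hcq]
  exact mul_le_mul_of_nonneg_left (hre.trans hflat) hcq

/-- **EVEN face** (`g(−t) = g(t)`: then `g(−m) = g(m)` and the mirror-layer modulus follows from the layer one): the atom CHARGES the even
function its squared edge value, `|contribution_q(g) + w_q δ·‖g(m)‖²| ≤ w_q δ·Mδ·(2‖g(m)‖ + Mδ)` with `w_q δ = (2 log q/√q)·2δ`. [folklore] -/
theorem abs_contribution_add_flat_le_of_even (hg : IsWeilTest g) (hsupp : tsupport g ⊆ Icc (-b) b) (hev : ∀ t, g (-t) = g t) {q : ℕ}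
    {M : ℝ} (hM0 : 0 ≤ M) (hb : Real.log q / 2 ≤ b)
    (hM : ∀ u ∈ Icc (Real.log q - b) b, ‖g u - g (Real.log q / 2)‖ ≤ M * |u - Real.log q / 2|) :
    |contribution q g + 2 * Real.log q / Real.sqrt q * (2 * (b - Real.log q / 2)) * ‖g (Real.log q / 2)‖ ^ 2|
      ≤ 2 * Real.log q / Real.sqrt q * (2 * (b - Real.log q / 2) * (M * (b - Real.log q / 2) *
          (2 * ‖g (Real.log q / 2)‖ + M * (b - Real.log q / 2)))) := by
  have hM' : ∀ v ∈ Icc (-b) (b - Real.log q), ‖g v - g (-(Real.log q / 2))‖ ≤ M * |v + Real.log q / 2| := by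
    intro v hv
    have hv' : -v ∈ Icc (Real.log q - b) b := ⟨by linarith [hv.2], by linarith [hv.1]⟩
    have h := hM (-v) hv'
    rw [hev v, show -v - Real.log q / 2 = -(v + Real.log q / 2) from by ring, abs_neg] at h
    rwa [hev (Real.log q / 2)]
  have h := abs_contribution_add_flat_le hg hsupp hM0 hb hM hM'
  have hsq : (g (Real.log q / 2) * conj (g (-(Real.log q / 2)))).re = ‖g (Real.log q / 2)‖ ^ 2 := by
    rw [hev (Real.log q / 2), Complex.mul_conj, Complex.ofReal_re, Complex.normSq_eq_norm_sq]
  rw [hsq, hev (Real.log q / 2)] at h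
  refine h.trans (le_of_eq ?_)
  ring

/-- **ODD face** (`g(−t) = −g(t)`: `g(−m) = −g(m)`): the atom REWARDS the odd function its squared edge value,
`|contribution_q(g) − w_q δ·‖g(m)‖²| ≤ w_q δ·Mδ·(2‖g(m)‖ + Mδ)` — the kernel face of «odd carries the wall»: for a fixed odd shape the
rescue is `+w_q δ·η²` to first order in `δ`, `η = g((log q)/2)` the edge value (kappa.py's `c(δ)·η²`). [folklore] -/
theorem abs_contribution_sub_flat_le_of_odd (hg : IsWeilTest g) (hsupp : tsupport g ⊆ Icc (-b) b) (hodd : ∀ t, g (-t) = -g t) {q : ℕ}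
    {M : ℝ} (hM0 : 0 ≤ M) (hb : Real.log q / 2 ≤ b)
    (hM : ∀ u ∈ Icc (Real.log q - b) b, ‖g u - g (Real.log q / 2)‖ ≤ M * |u - Real.log q / 2|) :
    |contribution q g - 2 * Real.log q / Real.sqrt q * (2 * (b - Real.log q / 2)) * ‖g (Real.log q / 2)‖ ^ 2|
      ≤ 2 * Real.log q / Real.sqrt q * (2 * (b - Real.log q / 2) * (M * (b - Real.log q / 2) *
          (2 * ‖g (Real.log q / 2)‖ + M * (b - Real.log q / 2)))) := by
  have hM' : ∀ v ∈ Icc (-b) (b - Real.log q), ‖g v - g (-(Real.log q / 2))‖ ≤ M * |v + Real.log q / 2| := by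
    intro v hv
    have hv' : -v ∈ Icc (Real.log q - b) b := ⟨by linarith [hv.2], by linarith [hv.1]⟩
    have h := hM (-v) hv'
    rw [hodd v, show -g v - g (Real.log q / 2) = -(g v + g (Real.log q / 2)) from by ring, norm_neg,
      show -v - Real.log q / 2 = -(v + Real.log q / 2) from by ring, abs_neg] at h
    rwa [hodd (Real.log q / 2), sub_neg_eq_add]
  have h := abs_contribution_add_flat_le hg hsupp hM0 hb hM hM'
  have hsq : (g (Real.log q / 2) * conj (g (-(Real.log q / 2)))).re = -‖g (Real.log q / 2)‖ ^ 2 := by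
    rw [hodd (Real.log q / 2), map_neg, mul_neg, Complex.neg_re, Complex.mul_conj, Complex.ofReal_re, Complex.normSq_eq_norm_sq]
  rw [hsq, hodd (Real.log q / 2), norm_neg] at h
  have e2 : contribution q g - 2 * Real.log q / Real.sqrt q * (2 * (b - Real.log q / 2)) * ‖g (Real.log q / 2)‖ ^ 2
      = contribution q g + 2 * Real.log q / Real.sqrt q * (2 * (b - Real.log q / 2)) * -‖g (Real.log q / 2)‖ ^ 2 := by ring
  rw [e2]
  refine h.trans (le_of_eq ?_)
  ring

/-! ## §4 The Lipschitz modulus from a derivative bound on the layer (mean value inequality) -/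

/-- A derivative bound `‖g′‖ ≤ M` on the layer `[log q − b, b]` gives the Lipschitz modulus about the entrance point used above
(Mathlib's `Convex.norm_image_sub_le_of_norm_deriv_le`; `g` is smooth as a Weil test function). [folklore] -/
theorem layer_modulus_of_deriv_le (hg : IsWeilTest g) {q : ℕ} {M : ℝ} (hb : Real.log q / 2 ≤ b)
    (hD : ∀ u ∈ Icc (Real.log q - b) b, ‖deriv g u‖ ≤ M) :
    ∀ u ∈ Icc (Real.log q - b) b, ‖g u - g (Real.log q / 2)‖ ≤ M * |u - Real.log q / 2| := by
  intro u hu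
  have hm : Real.log q / 2 ∈ Icc (Real.log q - b) b := ⟨by linarith, hb⟩
  have hdiff : ∀ x ∈ Icc (Real.log q - b) b, DifferentiableAt ℝ g x :=
    fun x _ ↦ (hg.1.differentiable (by simp)).differentiableAt
  have h := (convex_Icc (Real.log q - b) b).norm_image_sub_le_of_norm_deriv_le hdiff hD hm hu
  rwa [Real.norm_eq_abs] at h

/-- **ODD face with a derivative bound** (the wall-carrying sector, in the form the cell's sections are read): for an odd Weil test function
supported in `[−b, b]` with `‖g′‖ ≤ M` on the layer, `|contribution_q(g) − w_q δ·‖g((log q)/2)‖²| ≤ w_q δ·Mδ·(2‖g((log q)/2)‖ + Mδ)`,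
`w_q δ = (2 log q/√q)·2δ`, `δ = b − (log q)/2`. [folklore] -/
theorem abs_contribution_sub_flat_le_of_odd_of_deriv_le (hg : IsWeilTest g) (hsupp : tsupport g ⊆ Icc (-b) b)
    (hodd : ∀ t, g (-t) = -g t) {q : ℕ} {M : ℝ} (hM0 : 0 ≤ M) (hb : Real.log q / 2 ≤ b)
    (hD : ∀ u ∈ Icc (Real.log q - b) b, ‖deriv g u‖ ≤ M) :
    |contribution q g - 2 * Real.log q / Real.sqrt q * (2 * (b - Real.log q / 2)) * ‖g (Real.log q / 2)‖ ^ 2|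
      ≤ 2 * Real.log q / Real.sqrt q * (2 * (b - Real.log q / 2) * (M * (b - Real.log q / 2) *
          (2 * ‖g (Real.log q / 2)‖ + M * (b - Real.log q / 2)))) :=
  abs_contribution_sub_flat_le_of_odd hg hsupp hodd hM0 hb (layer_modulus_of_deriv_le hg hb hD)

/-- **EVEN face with a derivative bound.** [folklore] -/
theorem abs_contribution_add_flat_le_of_even_of_deriv_le (hg : IsWeilTest g) (hsupp : tsupport g ⊆ Icc (-b) b)
    (hev : ∀ t, g (-t) = g t) {q : ℕ} {M : ℝ} (hM0 : 0 ≤ M) (hb : Real.log q / 2 ≤ b)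
    (hD : ∀ u ∈ Icc (Real.log q - b) b, ‖deriv g u‖ ≤ M) :
    |contribution q g + 2 * Real.log q / Real.sqrt q * (2 * (b - Real.log q / 2)) * ‖g (Real.log q / 2)‖ ^ 2|
      ≤ 2 * Real.log q / Real.sqrt q * (2 * (b - Real.log q / 2) * (M * (b - Real.log q / 2) *
          (2 * ‖g (Real.log q / 2)‖ + M * (b - Real.log q / 2)))) :=
  abs_contribution_add_flat_le_of_even hg hsupp hev hM0 hb (layer_modulus_of_deriv_le hg hb hD)

/-! ## §5 (append, gen12) THE KINKED CLASS: the same law for any `g` with an integrable cross term on the layer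

For a SMOOTH test function supported in `[−b, b]` the edge value `g(b)` vanishes, so `g(m) = g(b − δ) = O(δ)` and the flat main term
`w_q δ·‖g(m)‖²` is itself `O(δ³)`, of the same order as the remainder: §3 is then true but not informative. The cell's SECTIONS are KINKED
(piecewise-polynomial on `[−b, b]`, non-zero one-sided edge value `η = g(b⁻)`, zero outside): for them the main term is `w_q δ·η² + O(δ²)`
and the law is sharp — kappa.py's sentence. `contribution q g` (prove-2's definition through the convolution integral) makes sense for any
`g`; the estimates above used `IsWeilTest g` only for the integrability of the cross term on the layer, which is now taken as the
hypothesis (`hgi`). The Lipschitz moduli are required on the CLOSED layers `[log q − b, b]` and `[−b, b − log q]`, where a kinked function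
is continuous (its jumps sit on the outer side of `±b`). -/

/-- §2 for the kinked class: `‖∫_{layer} g(u)·conj g(u − log q) du − 2δ·g(m)·conj g(−m)‖ ≤ 2δ·Mδ·(‖g(m)‖ + ‖g(−m)‖ + Mδ)` assuming only
that the cross term is integrable on the layer. [folklore] -/
theorem norm_layerIntegral_sub_flat_le_of_integrableOn {q : ℕ} {M : ℝ}
    (hgi : IntegrableOn (fun u ↦ g u * conj (g (u - Real.log q))) (Icc (Real.log q - b) b)) (hM0 : 0 ≤ M)
    (hb : Real.log q / 2 ≤ b) (hM : ∀ u ∈ Icc (Real.log q - b) b, ‖g u - g (Real.log q / 2)‖ ≤ M * |u - Real.log q / 2|)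
    (hM' : ∀ v ∈ Icc (-b) (b - Real.log q), ‖g v - g (-(Real.log q / 2))‖ ≤ M * |v + Real.log q / 2|) :
    ‖(∫ u in Icc (Real.log q - b) b, g u * conj (g (u - Real.log q)))
        - (2 * (b - Real.log q / 2) : ℝ) • (g (Real.log q / 2) * conj (g (-(Real.log q / 2))))‖
      ≤ 2 * (b - Real.log q / 2) * (M * (b - Real.log q / 2) *
          (‖g (Real.log q / 2)‖ + ‖g (-(Real.log q / 2))‖ + M * (b - Real.log q / 2))) := by
  set L := Real.log q with hL
  set m := Real.log q / 2 with hm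
  set δ := b - m with hδ
  set S : Set ℝ := Icc (L - b) b with hS
  set c : ℂ := g m * conj (g (-m)) with hc
  have hLb : L - b ≤ b := by rw [hL]; linarith
  have hvol : volume.real S = 2 * δ := by
    rw [hS, Real.volume_real_Icc_of_le hLb, hδ, hm]; ring
  have hSfin : volume S < ⊤ := by rw [hS]; exact measure_Icc_lt_top
  have hconst : (2 * δ : ℝ) • c = ∫ u in S, c := by
    rw [setIntegral_const, hvol, Complex.real_smul]
  rw [hconst, ← integral_sub hgi (by rw [hS]; exact integrableOn_const (by simp))]
  have hpt : ∀ u ∈ S, ‖g u * conj (g (u - L)) - c‖ ≤ M * δ * (‖g m‖ + ‖g (-m)‖ + M * δ) := by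
    intro u hu
    have hu' : |u - m| ≤ δ := by
      rw [abs_le]; rw [hS, mem_Icc] at hu; constructor <;> [linarith [hu.1]; linarith [hu.2]]
    have hv : u - L ∈ Icc (-b) (b - L) := by rw [hS, mem_Icc] at hu; exact ⟨by linarith [hu.1], by linarith [hu.2]⟩
    have hv' : |u - L + m| ≤ δ := by
      have : u - L + m = u - m := by rw [hm, hL]; ring
      rw [this]; exact hu'
    have h1 : ‖g u - g m‖ ≤ M * δ := (hM u hu).trans (mul_le_mul_of_nonneg_left hu' hM0)
    have h2 : ‖g (u - L) - g (-m)‖ ≤ M * δ := by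
      have h := hM' (u - L) hv
      rw [show u - L + Real.log q / 2 = u - L + m from by rw [hm]] at h
      exact h.trans (mul_le_mul_of_nonneg_left hv' hM0)
    have h3 : ‖g (u - L)‖ ≤ ‖g (-m)‖ + M * δ := by
      calc ‖g (u - L)‖ = ‖g (-m) + (g (u - L) - g (-m))‖ := by ring_nf
        _ ≤ ‖g (-m)‖ + ‖g (u - L) - g (-m)‖ := norm_add_le _ _
        _ ≤ ‖g (-m)‖ + M * δ := by linarith [h2]
    have hsplit : g u * conj (g (u - L)) - c = (g u - g m) * conj (g (u - L)) + g m * (conj (g (u - L)) - conj (g (-m))) := by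
      rw [hc]; ring
    rw [hsplit]
    calc ‖(g u - g m) * conj (g (u - L)) + g m * (conj (g (u - L)) - conj (g (-m)))‖
        ≤ ‖(g u - g m) * conj (g (u - L))‖ + ‖g m * (conj (g (u - L)) - conj (g (-m)))‖ := norm_add_le _ _
      _ = ‖g u - g m‖ * ‖g (u - L)‖ + ‖g m‖ * ‖g (u - L) - g (-m)‖ := by
          rw [norm_mul, norm_mul, Complex.norm_conj, ← map_sub, Complex.norm_conj]
      _ ≤ M * δ * (‖g (-m)‖ + M * δ) + ‖g m‖ * (M * δ) := by
          gcongr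
      _ = M * δ * (‖g m‖ + ‖g (-m)‖ + M * δ) := by ring
  have hmain := norm_setIntegral_le_of_norm_le_const hSfin hpt
  rw [hvol] at hmain
  calc ‖∫ u in S, g u * conj (g (u - L)) - c‖ ≤ M * δ * (‖g m‖ + ‖g (-m)‖ + M * δ) * (2 * δ) := hmain
    _ = 2 * δ * (M * δ * (‖g m‖ + ‖g (-m)‖ + M * δ)) := by ring

/-- **THE FLAT-EDGE LAW FOR THE KINKED CLASS** (parity-free): for ANY `g` with `tsupport g ⊆ [−b, b]`, integrable cross term on the layer and
Lipschitz moduli `M` about `±(log q)/2` on the closed layers, `|contribution_q(g) + w_q δ·Re(g(m)·conj g(−m))| ≤ w_q δ·Mδ·(‖g(m)‖ + ‖g(−m)‖ + Mδ)`.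
For a kinked section bottom with edge value `η = g((log q)/2 ± δ)` this is «atom = ∓w_q δ·η² + O(δ²)». [folklore] -/
theorem abs_contribution_add_flat_le_of_integrableOn (hsupp : tsupport g ⊆ Icc (-b) b) {q : ℕ} {M : ℝ}
    (hgi : IntegrableOn (fun u ↦ g u * conj (g (u - Real.log q))) (Icc (Real.log q - b) b)) (hM0 : 0 ≤ M)
    (hb : Real.log q / 2 ≤ b) (hM : ∀ u ∈ Icc (Real.log q - b) b, ‖g u - g (Real.log q / 2)‖ ≤ M * |u - Real.log q / 2|)
    (hM' : ∀ v ∈ Icc (-b) (b - Real.log q), ‖g v - g (-(Real.log q / 2))‖ ≤ M * |v + Real.log q / 2|) :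
    |contribution q g + 2 * Real.log q / Real.sqrt q * (2 * (b - Real.log q / 2)) *
        (g (Real.log q / 2) * conj (g (-(Real.log q / 2)))).re|
      ≤ 2 * Real.log q / Real.sqrt q * (2 * (b - Real.log q / 2) * (M * (b - Real.log q / 2) *
          (‖g (Real.log q / 2)‖ + ‖g (-(Real.log q / 2))‖ + M * (b - Real.log q / 2)))) := by
  have hcq : 0 ≤ 2 * Real.log q / Real.sqrt q :=
    div_nonneg (mul_nonneg zero_le_two (Real.log_natCast_nonneg q)) (Real.sqrt_nonneg _)
  rw [contribution_eq_neg_mul_re_layerIntegral hsupp q]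
  set cq := 2 * Real.log q / Real.sqrt q with hcq_def
  set I := ∫ u in Icc (Real.log q - b) b, g u * conj (g (u - Real.log q)) with hI
  set c : ℂ := (2 * (b - Real.log q / 2) : ℝ) • (g (Real.log q / 2) * conj (g (-(Real.log q / 2)))) with hc
  have hre : |I.re - c.re| ≤ ‖I - c‖ := by
    rw [← Complex.sub_re]
    exact Complex.abs_re_le_norm _
  have hflat := norm_layerIntegral_sub_flat_le_of_integrableOn hgi hM0 hb hM hM'
  have hcre : c.re = 2 * (b - Real.log q / 2) * (g (Real.log q / 2) * conj (g (-(Real.log q / 2)))).re := by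
    rw [hc, Complex.real_smul, Complex.re_ofReal_mul]
  have e : -(cq * I.re) + cq * (2 * (b - Real.log q / 2)) * (g (Real.log q / 2) * conj (g (-(Real.log q / 2)))).re
      = -(cq * (I.re - c.re)) := by
    rw [hcre]; ring
  rw [e, abs_neg, abs_mul, abs_of_nonneg hcq]
  exact mul_le_mul_of_nonneg_left (hre.trans hflat) hcq

/-- ODD kinked face: `|contribution_q(g) − w_q δ·‖g((log q)/2)‖²| ≤ w_q δ·Mδ·(2‖g((log q)/2)‖ + Mδ)` for ANY odd `g` supported in `[−b, b]`
with an integrable cross term and layer modulus `M` — the kernel form of «the deleted prime REWARDS an odd section by w_q δ·η² to first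
order» (η the edge value), i.e. of kappa.py's `c(δ)·η²` with `c(δ) = w_q·δ`. [folklore] -/
theorem abs_contribution_sub_flat_le_of_odd_of_integrableOn (hsupp : tsupport g ⊆ Icc (-b) b) (hodd : ∀ t, g (-t) = -g t) {q : ℕ}
    {M : ℝ} (hgi : IntegrableOn (fun u ↦ g u * conj (g (u - Real.log q))) (Icc (Real.log q - b) b)) (hM0 : 0 ≤ M)
    (hb : Real.log q / 2 ≤ b) (hM : ∀ u ∈ Icc (Real.log q - b) b, ‖g u - g (Real.log q / 2)‖ ≤ M * |u - Real.log q / 2|) :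
    |contribution q g - 2 * Real.log q / Real.sqrt q * (2 * (b - Real.log q / 2)) * ‖g (Real.log q / 2)‖ ^ 2|
      ≤ 2 * Real.log q / Real.sqrt q * (2 * (b - Real.log q / 2) * (M * (b - Real.log q / 2) *
          (2 * ‖g (Real.log q / 2)‖ + M * (b - Real.log q / 2)))) := by
  have hM' : ∀ v ∈ Icc (-b) (b - Real.log q), ‖g v - g (-(Real.log q / 2))‖ ≤ M * |v + Real.log q / 2| := by
    intro v hv
    have hv' : -v ∈ Icc (Real.log q - b) b := ⟨by linarith [hv.2], by linarith [hv.1]⟩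
    have h := hM (-v) hv'
    rw [hodd v, show -g v - g (Real.log q / 2) = -(g v + g (Real.log q / 2)) from by ring, norm_neg,
      show -v - Real.log q / 2 = -(v + Real.log q / 2) from by ring, abs_neg] at h
    rwa [hodd (Real.log q / 2), sub_neg_eq_add]
  have h := abs_contribution_add_flat_le_of_integrableOn hsupp hgi hM0 hb hM hM'
  have hsq : (g (Real.log q / 2) * conj (g (-(Real.log q / 2)))).re = -‖g (Real.log q / 2)‖ ^ 2 := by
    rw [hodd (Real.log q / 2), map_neg, mul_neg, Complex.neg_re, Complex.mul_conj, Complex.ofReal_re, Complex.normSq_eq_norm_sq]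
  rw [hsq, hodd (Real.log q / 2), norm_neg] at h
  have e2 : contribution q g - 2 * Real.log q / Real.sqrt q * (2 * (b - Real.log q / 2)) * ‖g (Real.log q / 2)‖ ^ 2
      = contribution q g + 2 * Real.log q / Real.sqrt q * (2 * (b - Real.log q / 2)) * -‖g (Real.log q / 2)‖ ^ 2 := by ring
  rw [e2]
  refine h.trans (le_of_eq ?_)
  ring

/-- EVEN kinked face: `|contribution_q(g) + w_q δ·‖g((log q)/2)‖²| ≤ w_q δ·Mδ·(2‖g((log q)/2)‖ + Mδ)` — the even section is CHARGED
`w_q δ·η²` to first order. [folklore] -/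
theorem abs_contribution_add_flat_le_of_even_of_integrableOn (hsupp : tsupport g ⊆ Icc (-b) b) (hev : ∀ t, g (-t) = g t) {q : ℕ}
    {M : ℝ} (hgi : IntegrableOn (fun u ↦ g u * conj (g (u - Real.log q))) (Icc (Real.log q - b) b)) (hM0 : 0 ≤ M)
    (hb : Real.log q / 2 ≤ b) (hM : ∀ u ∈ Icc (Real.log q - b) b, ‖g u - g (Real.log q / 2)‖ ≤ M * |u - Real.log q / 2|) :
    |contribution q g + 2 * Real.log q / Real.sqrt q * (2 * (b - Real.log q / 2)) * ‖g (Real.log q / 2)‖ ^ 2|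
      ≤ 2 * Real.log q / Real.sqrt q * (2 * (b - Real.log q / 2) * (M * (b - Real.log q / 2) *
          (2 * ‖g (Real.log q / 2)‖ + M * (b - Real.log q / 2)))) := by
  have hM' : ∀ v ∈ Icc (-b) (b - Real.log q), ‖g v - g (-(Real.log q / 2))‖ ≤ M * |v + Real.log q / 2| := by
    intro v hv
    have hv' : -v ∈ Icc (Real.log q - b) b := ⟨by linarith [hv.2], by linarith [hv.1]⟩
    have h := hM (-v) hv'
    rw [hev v, show -v - Real.log q / 2 = -(v + Real.log q / 2) from by ring, abs_neg] at h
    rwa [hev (Real.log q / 2)]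
  have h := abs_contribution_add_flat_le_of_integrableOn hsupp hgi hM0 hb hM hM'
  have hsq : (g (Real.log q / 2) * conj (g (-(Real.log q / 2)))).re = ‖g (Real.log q / 2)‖ ^ 2 := by
    rw [hev (Real.log q / 2), Complex.mul_conj, Complex.ofReal_re, Complex.normSq_eq_norm_sq]
  rw [hsq, hev (Real.log q / 2)] at h
  refine h.trans (le_of_eq ?_)
  ring

end Summit.RiemannHypothesis.RiemannHypothesis.Theorems.HandoffFlatEdge
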